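import Summits.BirchSwinnertonDyer.BirchSwinnertonDyer.Theorems.CongruentShaFreeCutKatoZetaRoadReadings
import Summits.BirchSwinnertonDyer.BirchSwinnertonDyer.Theorems.CongruentShaFreeCutKatoReading31
import Summits.BirchSwinnertonDyer.BirchSwinnertonDyer.Theorems.CongruentShaFreeCutIntegralH1RankLeOne
import Literature.NumberTheory.EllipticCurves.Kato2004.IwasawaH1RankLeOneProofs
import Literature.NumberTheory.EllipticCurves.Kato2004.IwasawaCohomologyExistsProofs
import HarnessLib

set_option linter.dupNamespace false
set_option autoImplicit false

/-! # Readings (R+K) and (3.1′) of the Kato–zeta road from «`𝐇¹_Γ(T_pW) ≠ 0`» ALONE, under the crux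
# hypotheses — `thm12_4` leaves the road except for its non-vanishing half (rungs S2/S2b of
# `BirchSwinnertonDyer`, cruxes `AnalyticRankOneOfRankOneFiniteSha{Two,Three}`, stmt-BirchSwinnertonDyer-19080 / -19160)

Cell `bsd-cn100`, prover seat `bsd-cn100-s2-c3` (g12). Helper for stmt-BirchSwinnertonDyer-19080 and, being
`W,p`-generic, for its S2b twin stmt-BirchSwinnertonDyer-19160. THEOREMS ONLY (no definition, no named fact,
no instance); no `Theses` import (standing build rule 2026-08-26T19:13:48Z (H): this file concludes no route
decl). PARTITION: none — RANK axis.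

## What is proved

On the registered lines `kato-zeta-perrin-riou` (v1g: RI7 = six refereed theorems ∧ `Kato2004.thm12_4`) the
in-skeleton readings are `readingRK := readingRK_congruentNumberCurve_of_facts h1 h2 thm12_4` and
`reading31 := reading31_of_fact (finite_descentCokernel_of_rankOne_of_nonempty_of_thm12_4 h2 thm12_4)`.
Of `thm12_4` these consume (12.2.1) `Module.Finite Λ 𝐇¹`, torsion-freeness and `rank_Λ 𝐇¹ = 1`. Now:
(12.2.1) is `Kato2004.IwasawaH1Data.module_finite_of_isCyclotomic` (bsd-potss-rkm g8, p510488), torsion-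
freeness is `Kato2004.IwasawaH1Data.isTorsionFree` (rkm g7), (α) is `nonempty_iwasawaH2Data_holds` (p510488),
(R1) is `rank_integralH1_layerZero_le_one` (this seat g11, p508547) and (R2) «(R1) ⟹ rank_Λ 𝐇¹ ≤ 1» is
`Kato2004.IwasawaH1Data.rank_le_one_of_rank_integralH1_le_one` (this seat g12). Hence, UNDER THE CRUX
HYPOTHESES `rank W(ℚ) = 1 ∧ #Ш(W)[p^∞] < ∞`, both readings follow from the single displayed input

  (NT) `∀ W p κ γ, κ.IsCyclotomic → κ.IsTopGenerator γ → ∀ I : IwasawaH1Data W p κ γ, Nontrivial I.H`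

(«`𝐇¹_Γ(T_pW) ≠ 0`», the LOWER half of Kato Thm. 12.4 (2) — the non-vanishing of the Euler system of zeta
elements, Kato Thm. 12.5 with Rohrlich; implied by `thm12_4`: `Kato2004.nontrivial_iwasawaH1_of_thm12_4`):

* `exists_pin_charIdeal_rel_of_nontrivial_of_rankOne` — generic `W, p`: (NT) ∧ rank one ∧ `Ш[p^∞]` finite ⟹
  a v2-pinned descent datum with `∃ a b, (p^a)·char(D.H2) = (p^b)·char(D.H ⧸ Λ D.z)` EXISTS.
* `readingRK_congruentNumberCurve_of_nontrivial`, `readingRK_jZero_three_of_nontrivial` — the two registered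
  `readingRK` shapes WITH the crux hypotheses `mordellWeilRank = 1 → Finite Ш[p^∞] →` inserted (the
  compositions use `hRK` only after these are in context; the re-cut compositions are
  `Theorems/CongruentShaFreeCutKatoZetaRoadNontrivialH1.lean`).
* `finite_descentCokernel_of_rankOne_of_nontrivial` — the former RI conjunct `finite_descentCokernel_of_rankOne`
  from (NT) ALONE ((R1) discharged); `reading31_of_nontrivial` — the registered `reading31` of 19080 from (NT).
* `…_of_nontrivial_rankOne` variants — the same from the CRUX-LOCAL non-vanishing
  (NT′) `… → W.mordellWeilRank = 1 → Finite Ш[p^∞] → Nontrivial I.H`.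

HONEST FRAMING: (NT) is a displayed hypothesis, NOT proved (it is where Kato's zeta elements enter); the
char-ideal relation is realised by a CHOICE of `z` (ty g8), not Kato's Main Conjecture; nothing about the
Perrin-Riou formula `PRFormulaAt{Two,Three}H2`, crux B, the leaves, CN/Sylvester or BSD is proved.

References: K. Kato, Astérisque 295 (2004), §12.2 (12.2.1), Thm. 12.4, Thm. 12.5, §14.14 (14.14.1)
[Kato2004Asterisque]; tree files named above.
-/

noncomputable section

open scoped Classical

namespace Summit.BirchSwinnertonDyer.BirchSwinnertonDyer.Theorems.CongruentShaFreeCutKatoReadingsOfNontrivialH1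

open WeierstrassCurve Field Literature.NumberTheory.EllipticCurves
  Literature.NumberTheory.EllipticCurves.Kato2004 Literature.NumberTheory.EllipticCurves.IwasawaAlgebra
  Literature.NumberTheory.EllipticCurves.Kato2004.EulerSystemValues
  Literature.NumberTheory.GaloisRepresentations
open Summit.BirchSwinnertonDyer.Rank1Residual.Additive (KatoDescentDatum)
open Summit.BirchSwinnertonDyer.BirchSwinnertonDyer.Theorems.CongruentShaFreeCutKatoDescentDatumOfH2
open Summit.BirchSwinnertonDyer.BirchSwinnertonDyer.Theorems.CongruentShaFreeCutKatoZetaRoadReadings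
  (exists_pin_charIdeal_rel_of_packages)
open Summit.BirchSwinnertonDyer.BirchSwinnertonDyer.Theorems.CongruentShaFreeCutIntegralH1RankLeOne
  (rank_integralH1_layerZero_le_one)
open Summit.BirchSwinnertonDyer.BirchSwinnertonDyer.Theorems.CongruentShaFreeCutKatoReading31 (reading31_of_fact)

/-! ## §1 (R+K) on given `W, p` under the crux hypotheses, from «`𝐇¹ ≠ 0`» -/

/-- **A v2-pinned descent datum with the «main-conjecture-type» relation EXISTS, for `W/ℚ` of rank one with
finite `Ш[p^∞]`, granted only «`𝐇¹_Γ(T_pW) ≠ 0`» at the cyclotomic pins of `(W, p)`.** `κ` = the tree's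
cyclotomic `ℤ_p`-extension, `γ` any preimage of `1`; `I` from `nonempty_iwasawaH1Data_holds`, `J` from
`nonempty_iwasawaH2Data_holds` ((α), p510488); (12.2.1) + torsion-freeness + `rank = 1` from (R1)
(`rank_integralH1_layerZero_le_one`, p508547) and (R2)
(`IwasawaH1Data.thm12_4_clauses_of_nontrivial_of_rank_integralH1_le_one`); then ty g8's
`exists_pin_charIdeal_rel_of_packages`. CONDITIONAL on the displayed `hNT`; `z` is CHOSEN.
[cite: Kato2004Asterisque, §12.2 (12.2.1) (p. 220), Thm. 12.4 (2) (p. 221), §14.14 (14.14.1) (p. 243)] -/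
theorem exists_pin_charIdeal_rel_of_nontrivial_of_rankOne (W : WeierstrassCurve ℚ) [W.IsElliptic] (p : ℕ)
    [Fact p.Prime] [ContinuousSMul ℤ_[p] (W.tateModule p)]
    (hNT : ∀ (κ : ZpExtension ℚ p) (γ : absoluteGaloisGroup ℚ), κ.IsCyclotomic → κ.IsTopGenerator γ →
      ∀ I : IwasawaH1Data W p κ γ, Nontrivial I.H)
    (hrank : W.mordellWeilRank = 1) (hsha : Finite (AddCommGroup.primaryComponent W.sha p)) :
    ∃ D : KatoDescentDatum p, Nonempty (KatoDescentDatumPinH2 W p D) ∧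
      ∃ a b : ℕ,
        Ideal.span {((p : ℕ) : IwasawaAlgebra p) ^ a} * Module.charIdeal (IwasawaAlgebra p) D.H2 =
          Ideal.span {((p : ℕ) : IwasawaAlgebra p) ^ b} *
            Module.charIdeal (IwasawaAlgebra p) (D.H ⧸ (IwasawaAlgebra p) ∙ D.z) := by
  obtain ⟨κ, hκ⟩ := ZpExtension.exists_isCyclotomic_holds ℚ p
    (GaloisRep.cyclotomicCharacter_range_infinite ℚ p)
  obtain ⟨γ, hγ⟩ := κ.surjective (Multiplicative.ofAdd 1)
  have hγ' : κ.IsTopGenerator γ := hγ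
  obtain ⟨I⟩ := nonempty_iwasawaH1Data_holds W p κ γ hκ hγ'
  haveI : Nontrivial I.H := hNT κ γ hκ hγ' I
  haveI := hsha
  obtain ⟨hfin, ⟨htf, hrk⟩⟩ := I.thm12_4_clauses_of_nontrivial_of_rank_integralH1_le_one hκ hγ'
    (rank_integralH1_layerZero_le_one W p κ hrank)
  obtain ⟨J⟩ := nonempty_iwasawaH2Data_holds W p κ γ hκ hγ' I
  exact exists_pin_charIdeal_rel_of_packages W p hκ hγ' I hfin htf hrk J

/-! ## §2 The two registered `readingRK` shapes, with the crux hypotheses inserted -/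

/-- **`readingRK` of stmt-BirchSwinnertonDyer-19080 UNDER THE CRUX HYPOTHESES, from (NT) alone** (the
registered shape with `mordellWeilRank = 1 → Finite Ш[2^∞] →` inserted before the conclusion; consumed by the
re-cut composition `CongruentShaFreeCutKatoZetaRoadNontrivialH1.cruxB_of_prFormulaH2_of_readings_rankOne`).
[cite: Kato2004Asterisque, Thm. 12.4 (2) (p. 221) and §14.14 (14.14.1) (p. 243)] -/
theorem readingRK_congruentNumberCurve_of_nontrivial
    (hNT : ∀ (W : WeierstrassCurve ℚ) [W.IsElliptic] (p : ℕ) [Fact p.Prime]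
      [ContinuousSMul ℤ_[p] (W.tateModule p)] (κ : ZpExtension ℚ p) (γ : absoluteGaloisGroup ℚ),
      κ.IsCyclotomic → κ.IsTopGenerator γ → ∀ I : IwasawaH1Data W p κ γ, Nontrivial I.H) :
    ∀ ⦃n : ℕ⦄, Squarefree n →
      ∀ [(congruentNumberCurve n).IsElliptic] [(congruentNumberCurve n).IsGloballyMinimal]
        [ContinuousSMul ℤ_[2] ((congruentNumberCurve n).tateModule 2)],
        (congruentNumberCurve n).mordellWeilRank = 1 →
          Finite (AddCommGroup.primaryComponent (congruentNumberCurve n).sha 2) →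
        ∃ D : KatoDescentDatum 2, Nonempty (KatoDescentDatumPinH2 (congruentNumberCurve n) 2 D) ∧
          ∃ a b : ℕ,
            Ideal.span {((2 : ℕ) : IwasawaAlgebra 2) ^ a} * Module.charIdeal (IwasawaAlgebra 2) D.H2 =
              Ideal.span {((2 : ℕ) : IwasawaAlgebra 2) ^ b} *
                Module.charIdeal (IwasawaAlgebra 2) (D.H ⧸ (IwasawaAlgebra 2) ∙ D.z) :=
  fun n _ _ _ _ hrank hsha ↦
    exists_pin_charIdeal_rel_of_nontrivial_of_rankOne (congruentNumberCurve n) 2 (hNT (congruentNumberCurve n) 2)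
      hrank hsha

/-- The same from the CRUX-LOCAL non-vanishing (NT′) «for square-free `n` with `rank E_n(ℚ) = 1` and
`#Ш(E_n)[2^∞] < ∞`, `𝐇¹_Γ(T₂E_n) ≠ 0` at the cyclotomic pins» — the sharpest form of what the road asks of
Kato Thm. 12.4 (2). [cite: Kato2004Asterisque, Thm. 12.4 (2) (p. 221) and Thm. 12.5 (p. 222)] -/
theorem readingRK_congruentNumberCurve_of_nontrivial_rankOne
    (hNT : ∀ ⦃n : ℕ⦄, Squarefree n →
      ∀ [(congruentNumberCurve n).IsElliptic] [ContinuousSMul ℤ_[2] ((congruentNumberCurve n).tateModule 2)]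
        (κ : ZpExtension ℚ 2) (γ : absoluteGaloisGroup ℚ), κ.IsCyclotomic → κ.IsTopGenerator γ →
        ∀ I : IwasawaH1Data (congruentNumberCurve n) 2 κ γ,
          (congruentNumberCurve n).mordellWeilRank = 1 →
            Finite (AddCommGroup.primaryComponent (congruentNumberCurve n).sha 2) → Nontrivial I.H) :
    ∀ ⦃n : ℕ⦄, Squarefree n →
      ∀ [(congruentNumberCurve n).IsElliptic] [(congruentNumberCurve n).IsGloballyMinimal]
        [ContinuousSMul ℤ_[2] ((congruentNumberCurve n).tateModule 2)],
        (congruentNumberCurve n).mordellWeilRank = 1 →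
          Finite (AddCommGroup.primaryComponent (congruentNumberCurve n).sha 2) →
        ∃ D : KatoDescentDatum 2, Nonempty (KatoDescentDatumPinH2 (congruentNumberCurve n) 2 D) ∧
          ∃ a b : ℕ,
            Ideal.span {((2 : ℕ) : IwasawaAlgebra 2) ^ a} * Module.charIdeal (IwasawaAlgebra 2) D.H2 =
              Ideal.span {((2 : ℕ) : IwasawaAlgebra 2) ^ b} *
                Module.charIdeal (IwasawaAlgebra 2) (D.H ⧸ (IwasawaAlgebra 2) ∙ D.z) :=
  fun n hsq _ _ _ hrank hsha ↦
    exists_pin_charIdeal_rel_of_nontrivial_of_rankOne (congruentNumberCurve n) 2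
      (fun κ γ hκ hγ I ↦ hNT hsq κ γ hκ hγ I hrank hsha) hrank hsha

/-- **`readingRK` of stmt-BirchSwinnertonDyer-19160 (S2b twin: `j = 0`, `p = 3`) UNDER THE CRUX HYPOTHESES,
from (NT) alone** (the hypotheses `IsGloballyMinimal`, `j = 0` are not used).
[cite: Kato2004Asterisque, Thm. 12.4 (2) (p. 221) and §14.14 (14.14.1) (p. 243)] -/
theorem readingRK_jZero_three_of_nontrivial
    (hNT : ∀ (W : WeierstrassCurve ℚ) [W.IsElliptic] (p : ℕ) [Fact p.Prime]
      [ContinuousSMul ℤ_[p] (W.tateModule p)] (κ : ZpExtension ℚ p) (γ : absoluteGaloisGroup ℚ),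
      κ.IsCyclotomic → κ.IsTopGenerator γ → ∀ I : IwasawaH1Data W p κ γ, Nontrivial I.H) :
    ∀ (W : WeierstrassCurve ℚ) [W.IsElliptic] [W.IsGloballyMinimal]
      [ContinuousSMul ℤ_[3] (W.tateModule 3)], W.j = 0 →
        W.mordellWeilRank = 1 → Finite (AddCommGroup.primaryComponent W.sha 3) →
        ∃ D : KatoDescentDatum 3, Nonempty (KatoDescentDatumPinH2 W 3 D) ∧
          ∃ a b : ℕ,
            Ideal.span {((3 : ℕ) : IwasawaAlgebra 3) ^ a} * Module.charIdeal (IwasawaAlgebra 3) D.H2 =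
              Ideal.span {((3 : ℕ) : IwasawaAlgebra 3) ^ b} *
                Module.charIdeal (IwasawaAlgebra 3) (D.H ⧸ (IwasawaAlgebra 3) ∙ D.z) :=
  fun W _ _ _ _ hrank hsha ↦ exists_pin_charIdeal_rel_of_nontrivial_of_rankOne W 3 (hNT W 3) hrank hsha

/-! ## §3 (3.1′): the former RI conjunct `finite_descentCokernel_of_rankOne` and `reading31` from (NT) alone -/

/-- **`Kato2004.finite_descentCokernel_of_rankOne` from (NT) ALONE** — (α) is `nonempty_iwasawaH2Data_holds`,
(12.2.1)/torsion-freeness are tree theorems, (R1) is `rank_integralH1_layerZero_le_one` (p508547); the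
assembly is `Kato2004.finite_descentCokernel_of_rankOne_of_nontrivial_of_rank_le_one` (this seat, g12).
[cite: Kato2004Asterisque, §14.14 (14.14.1) (p. 243), Thm. 12.4 (2) (p. 221), §14.9 (14.9.3) (p. 240)] -/
theorem finite_descentCokernel_of_rankOne_of_nontrivial
    (hNT : ∀ (W : WeierstrassCurve ℚ) [W.IsElliptic] (p : ℕ) [Fact p.Prime]
      [ContinuousSMul ℤ_[p] (W.tateModule p)] (κ : ZpExtension ℚ p) (γ : absoluteGaloisGroup ℚ),
      κ.IsCyclotomic → κ.IsTopGenerator γ → ∀ I : IwasawaH1Data W p κ γ, Nontrivial I.H) :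
    finite_descentCokernel_of_rankOne :=
  finite_descentCokernel_of_rankOne_of_nontrivial_of_rank_le_one hNT fun W _ p _ _ κ hrank hsha ↦ by
    haveI := hsha
    exact rank_integralH1_layerZero_le_one W p κ hrank

/-- The same from the CRUX-LOCAL non-vanishing (NT′) «`rank W(ℚ) = 1 → #Ш(W)[p^∞] < ∞ → 𝐇¹_Γ(T_pW) ≠ 0`».
[cite: Kato2004Asterisque, §14.14 (14.14.1) (p. 243) and Thm. 12.4 (2) (p. 221)] -/
theorem finite_descentCokernel_of_rankOne_of_nontrivial_rankOne
    (hNT : ∀ (W : WeierstrassCurve ℚ) [W.IsElliptic] (p : ℕ) [Fact p.Prime]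
      [ContinuousSMul ℤ_[p] (W.tateModule p)] (κ : ZpExtension ℚ p) (γ : absoluteGaloisGroup ℚ),
      κ.IsCyclotomic → κ.IsTopGenerator γ → ∀ I : IwasawaH1Data W p κ γ,
        W.mordellWeilRank = 1 → Finite (AddCommGroup.primaryComponent W.sha p) → Nontrivial I.H) :
    finite_descentCokernel_of_rankOne :=
  finite_descentCokernel_of_rankOne_of_nontrivial_of_rankOne_of_rank_le_one hNT fun W _ p _ _ κ hrank hsha ↦ by
    haveI := hsha
    exact rank_integralH1_layerZero_le_one W p κ hrank

/-- **`reading31` of stmt-BirchSwinnertonDyer-19080 (registered shape, token for token) from (NT) alone**: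
`reading31_of_fact (finite_descentCokernel_of_rankOne_of_nontrivial hNT)`.
[cite: Kato2004Asterisque, (14.9.3) (p. 240) and §14.14 (14.14.2) (p. 243)] [cite: AlpogeBhargavaShnidman2022, App. A §10.1.3 (p. 34)] -/
theorem reading31_of_nontrivial
    (hNT : ∀ (W : WeierstrassCurve ℚ) [W.IsElliptic] (p : ℕ) [Fact p.Prime]
      [ContinuousSMul ℤ_[p] (W.tateModule p)] (κ : ZpExtension ℚ p) (γ : absoluteGaloisGroup ℚ),
      κ.IsCyclotomic → κ.IsTopGenerator γ → ∀ I : IwasawaH1Data W p κ γ, Nontrivial I.H) :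
    ∀ ⦃n : ℕ⦄, Squarefree n →
      ∀ [(congruentNumberCurve n).IsElliptic] [(congruentNumberCurve n).IsGloballyMinimal]
        [ContinuousSMul ℤ_[2] ((congruentNumberCurve n).tateModule 2)]
        (D : KatoDescentDatum 2), Nonempty (KatoDescentDatumPinH2 (congruentNumberCurve n) 2 D) →
        (congruentNumberCurve n).mordellWeilRank = 1 →
          Finite (AddCommGroup.primaryComponent (congruentNumberCurve n).sha 2) →
            Finite (IwasawaAlgebra.coinvariants 2 D.H2) :=
  reading31_of_fact (finite_descentCokernel_of_rankOne_of_nontrivial hNT)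

end Summit.BirchSwinnertonDyer.BirchSwinnertonDyer.Theorems.CongruentShaFreeCutKatoReadingsOfNontrivialH1

end
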